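import Literature.NumberTheory.CubicFields.PureCubicLabelBounds
import Literature.NumberTheory.NumberFields.PureCubicOrder
import HarnessLib

/-!
# Canonical lattice codes of the fractional ideals of a pure cubic field: existence and size

Topic `Literature/NumberTheory/CubicFields`; theorem-only sequel of `PureCubicLatticeSemantics.lean`
(`Canon`, `Mem`, `canon_unique`, `mem_latOfGens_iff`) and `PureCubicLabelBounds.lean`. For the pure cubic field
`K = ℚ(θ)`, `θ³ = ab²` (`ab` squarefree, `≠ 1`), with Dedekind's basis `(1, θ, θ₂)`, `θ₂ = θ²/b`:

* `exists_canon_code` — EVERY nonzero fractional ideal `J` of `𝓞_K` has a canonical code `c`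
  (`Canon c`, member set `= J`): `3n · J ⊆ ℤ⟨1, θ, θ₂⟩` for a denominator `n` of `J` (Dedekind's
  `3 𝓞_K ⊆ ℤ⟨1, θ, θ₂⟩`), the coordinate rows of `3n · J` form a finitely generated full-rank subgroup of
  `ℤ³`, and `latOfGens` of a generating list is the code; it is unique by `canon_unique`;
* `entries_le_den_mul` — if `M`, `Mθ`, `Mθ₂` are members (`M ≥ 1`) then every entry lies in `[0, den · M]`;
* `den_mul_absNorm_le_three` — for `J ∋ 1` (an over-order, e.g. a reduced ideal or a product of two):
  `den · N(J) ≤ 3`, and every entry is `≤ den` (`entries_le_of_one_mem`);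
* `den_dvd_three_of_integral`, `entries_le_of_integral` — for an integral ideal `𝔞 ≠ 0`: `den ∣ 3` and the
  entries are `≤ 3 N(𝔞)`.

These are the size bounds that keep the clamps of the class-group table (`CubicClassTable.clampL`) silent on
the codes of reduced ideals, of their pairwise products, and of the degree-one primes.

## References

* H. Cohen, *A Course in Computational Algebraic Number Theory*, GTM 138, Springer 1993, §4.7.1 (HNF codes of
  modules and ideals), §6.4.5. [Cohen1993]
-/

namespace Literature.NumberTheory.CubicFields

open scoped NumberField nonZeroDivisors
open NumberField PureCubicCodes
open Literature.NumberTheory.NumberFields.PureCubic (coords_eq_zero three_mul_mem_order isIntegral_theta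
  isIntegral_theta₂ ne_zero_of_squarefree_mul)

section IdealCodes

variable {K : Type*} [Field K] [NumberField K] {a b : ℕ} {θ : K}
variable (hdeg : Module.finrank ℚ K = 3) (hab : Squarefree (a * b)) (hab1 : a * b ≠ 1)
  (hθ : θ ^ 3 = ((a * b ^ 2 : ℕ) : K))

/-- A nonzero element of `𝓞 K` divides a positive natural number (its absolute norm). [folklore] -/
theorem exists_nat_mem_span_singleton {x : 𝓞 K} (hx : x ≠ 0) : ∃ n : ℕ, 1 ≤ n ∧ ∃ y : 𝓞 K, y * x = (n : 𝓞 K) := by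
  refine ⟨(Algebra.norm ℤ x).natAbs, ?_, ?_⟩
  · rw [Nat.one_le_iff_ne_zero, Ne, Int.natAbs_eq_zero]; exact Algebra.norm_ne_zero_iff.mpr hx
  · rw [← Ideal.mem_span_singleton', ← Ideal.absNorm_span_singleton x]
    exact Ideal.absNorm_mem _

/-- **A common denominator**: every fractional ideal `J` lies in `(1/n) 𝓞_K` for some `n ≥ 1`. [folklore] -/
theorem exists_nat_denominator (J : FractionalIdeal (𝓞 K)⁰ K) :
    ∃ n : ℕ, 1 ≤ n ∧ ∀ φ ∈ J, ∃ ξ : 𝓞 K, (n : K) * φ = ξ := by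
  obtain ⟨x, hx, hint⟩ := J.isFractional
  have hx0 : x ≠ 0 := nonZeroDivisors.ne_zero hx
  obtain ⟨n, hn, y, hy⟩ := exists_nat_mem_span_singleton hx0
  refine ⟨n, hn, fun φ hφ => ?_⟩
  obtain ⟨z, hz⟩ := hint φ ((FractionalIdeal.mem_coe).mpr hφ)
  refine ⟨y * z, ?_⟩
  rw [Algebra.smul_def] at hz
  have hn' : (n : K) = algebraMap (𝓞 K) K y * algebraMap (𝓞 K) K x := by
    rw [← map_mul, hy, map_natCast]
  rw [hn', mul_assoc, ← hz, ← map_mul]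

/-- **A nonzero fractional ideal contains a positive natural number.** [folklore] -/
theorem exists_nat_mem (J : FractionalIdeal (𝓞 K)⁰ K) (hJ : J ≠ 0) : ∃ z : ℕ, 1 ≤ z ∧ (z : K) ∈ J := by
  have hJ' : (J : Submodule (𝓞 K) K) ≠ ⊥ := fun h => hJ (FractionalIdeal.coeToSubmodule_eq_bot.mp h)
  obtain ⟨w, hw, hw0⟩ := Submodule.exists_mem_ne_zero_of_ne_bot hJ'
  obtain ⟨ξ, m, hm, hξ⟩ := IsFractionRing.div_surjective (A := 𝓞 K) w
  have hm0 : algebraMap (𝓞 K) K m ≠ 0 := RingOfIntegers.coe_ne_zero_iff.mpr (nonZeroDivisors.ne_zero hm)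
  have hξw : algebraMap (𝓞 K) K ξ = algebraMap (𝓞 K) K m * w := by rw [← hξ, mul_div_cancel₀ _ hm0]
  have hξJ : algebraMap (𝓞 K) K ξ ∈ J := by
    rw [hξw, ← Algebra.smul_def]
    exact (FractionalIdeal.mem_coe).mp (Submodule.smul_mem _ m hw)
  have hξ0 : ξ ≠ 0 := by
    intro h
    rw [h, map_zero] at hξw
    exact mul_ne_zero hm0 hw0 hξw.symm
  obtain ⟨z, hz, y, hy⟩ := exists_nat_mem_span_singleton hξ0
  refine ⟨z, hz, ?_⟩
  have : (z : K) = algebraMap (𝓞 K) K y * algebraMap (𝓞 K) K ξ := by rw [← map_mul, hy, map_natCast]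
  rw [this, ← Algebra.smul_def]
  exact (FractionalIdeal.mem_coe).mp (Submodule.smul_mem _ y ((FractionalIdeal.mem_coe).mpr hξJ))

omit [NumberField K] in
/-- Fractional ideals are closed under multiplication by algebraic integers (as elements of `K`). [folklore] -/
theorem mul_mem_of_isIntegral [NumberField K] {J : FractionalIdeal (𝓞 K)⁰ K} {x φ : K} (hx : IsIntegral ℤ x)
    (hφ : φ ∈ J) : x * φ ∈ J := by
  have : x = algebraMap (𝓞 K) K ⟨x, hx⟩ := rfl
  rw [this, ← Algebra.smul_def]
  exact (FractionalIdeal.mem_coe).mp (Submodule.smul_mem _ _ ((FractionalIdeal.mem_coe).mpr hφ))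

include hdeg hab hab1 hθ in
/-- **Every nonzero fractional ideal has a canonical code.** [cite: Cohen1993, §4.7.1] -/
theorem exists_canon_code (J : FractionalIdeal (𝓞 K)⁰ K) (hJ : J ≠ 0) :
    ∃ c : ℕ × List ℤ, Canon c ∧ ∀ φ : K, Mem θ b c φ ↔ φ ∈ J := by
  classical
  obtain ⟨n, hn, hden⟩ := exists_nat_denominator J
  set D : ℕ := 3 * n with hD
  have hD1 : 1 ≤ D := by omega
  have hDK : (D : K) ≠ 0 := by exact_mod_cast (show D ≠ 0 by omega)
  -- every element of `J` has integer coordinates after multiplication by `D`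
  have hcoord : ∀ φ ∈ J, ∃ r : Row, (D : K) * φ = lin θ b r := by
    intro φ hφ
    obtain ⟨ξ, hξ⟩ := hden φ hφ
    obtain ⟨c₀, c₁, c₂, e⟩ := three_mul_mem_order hdeg hab hab1 hθ ξ
    refine ⟨(c₀, c₁, c₂), ?_⟩
    rw [hD, Nat.cast_mul, Nat.cast_ofNat, mul_assoc, hξ, e]
    rfl
  -- the subgroup of coordinate rows
  set S : AddSubgroup Row :=
    { carrier := {r | ∃ φ ∈ J, (D : K) * φ = lin θ b r}
      add_mem' := by
        rintro r r' ⟨φ, hφ, e⟩ ⟨φ', hφ', e'⟩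
        refine ⟨φ + φ', FractionalIdeal.mem_coe.mp (Submodule.add_mem _ (FractionalIdeal.mem_coe.mpr hφ)
          (FractionalIdeal.mem_coe.mpr hφ')), ?_⟩
        rw [mul_add, e, e', lin_add]
      zero_mem' := ⟨0, FractionalIdeal.zero_mem _, by rw [mul_zero, lin_zero]⟩
      neg_mem' := by
        rintro r ⟨φ, hφ, e⟩
        exact ⟨-φ, FractionalIdeal.mem_coe.mp (Submodule.neg_mem _ (FractionalIdeal.mem_coe.mpr hφ)),
          by rw [mul_neg, e, lin_neg]⟩ } with hS
  have hmemS : ∀ r : Row, r ∈ S ↔ ∃ φ ∈ J, (D : K) * φ = lin θ b r := fun r => Iff.rfl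
  -- it is finitely generated
  have hfg : S.FG := by
    rw [← AddSubgroup.toIntSubmodule_toAddSubgroup S, ← Submodule.fg_iff_addSubgroup_fg]
    exact IsNoetherian.noetherian _
  obtain ⟨T, hT⟩ := hfg
  set gens : List Row := T.toList with hgens
  have hclos : AddSubgroup.closure {x | x ∈ gens} = S := by
    rw [← hT]; congr 1; ext x; simp [hgens]
  -- full rank: a positive integer `z ∈ J`, so `D z e_i ∈ S`
  obtain ⟨z, hz, hzJ⟩ := exists_nat_mem J hJ
  have hθ₂ : IsIntegral ℤ (θ ^ 2 / (b : K)) := isIntegral_theta₂ hab hθ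
  have hθi : IsIntegral ℤ θ := isIntegral_theta hθ
  have hN0 : ((D * z : ℕ) : ℤ) ≠ 0 := by exact_mod_cast (show D * z ≠ 0 by positivity)
  have row_mem : ∀ {x : K} (r : Row), x ∈ J → lin θ b r = (D : K) * x → r ∈ S := fun r hx e => ⟨_, hx, e.symm⟩
  have h1 : ((((D * z : ℕ) : ℤ), 0, 0) : Row) ∈ S :=
    row_mem _ hzJ (by simp only [lin]; push_cast; ring)
  have h2 : ((0, ((D * z : ℕ) : ℤ), 0) : Row) ∈ S :=
    row_mem _ (mul_comm (z : K) θ ▸ mul_mem_of_isIntegral hθi hzJ) (by simp only [lin]; push_cast; ring)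
  have h3 : ((0, 0, ((D * z : ℕ) : ℤ)) : Row) ∈ S :=
    row_mem _ (mul_comm (z : K) _ ▸ mul_mem_of_isIntegral hθ₂ hzJ) (by simp only [lin]; push_cast; ring)
  rw [← hclos] at h1 h2 h3
  refine ⟨latOfGens D gens, canon_latOfGens hD1 gens hN0 h1 h2 h3, fun φ => ?_⟩
  rw [mem_latOfGens_iff θ b hD1, hclos]
  constructor
  · rintro ⟨r, ⟨φ', hφ', e'⟩, e⟩
    have : φ = φ' := mul_left_cancel₀ hDK (by rw [e, e'])
    rwa [this]
  · intro hφ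
    obtain ⟨r, e⟩ := hcoord φ hφ
    exact ⟨r, ⟨φ, hφ, e⟩, e⟩

omit [NumberField K] in
/-- **Entries are bounded by `den · M`** when `M`, `Mθ`, `Mθ₂` (`M ≥ 1`) are members of the canonical code:
the diagonal entries divide `den · M`, the others are reduced. [cite: Cohen1993, §4.7.1] -/
theorem entries_le_den_mul [CharZero K] (θ : K) (b : ℕ)
    (hind : ∀ c₀ c₁ c₂ : ℚ, (c₀ : K) + (c₁ : K) * θ + (c₂ : K) * (θ ^ 2 / (b : K)) = 0 → c₀ = 0 ∧ c₁ = 0 ∧ c₂ = 0)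
    {c : ℕ × List ℤ} (hc : Canon c) {M : ℕ} (hM : 1 ≤ M) (h1 : Mem θ b c (M : K)) (hθM : Mem θ b c ((M : K) * θ))
    (hθ₂M : Mem θ b c ((M : K) * (θ ^ 2 / (b : K)))) :
    ∀ h ∈ c.2, 0 ≤ h ∧ h ≤ (c.1 : ℤ) * M := by
  obtain ⟨h11, h12, h13, h22, h23, h33, hc2, p11, p22, p33, n12, l12, n13, l13, n23, l23, hD, -⟩ := hc
  have key : ∀ (u v w : ℤ) (x y z : ℤ),
      ((x : ℤ) : K) + ((y : ℤ) : K) * θ + ((z : ℤ) : K) * (θ ^ 2 / (b : K)) =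
        ((u * h11 : ℤ) : K) + ((u * h12 + v * h22 : ℤ) : K) * θ + ((u * h13 + v * h23 + w * h33 : ℤ) : K) * (θ ^ 2 / (b : K)) →
      x = u * h11 ∧ y = u * h12 + v * h22 ∧ z = u * h13 + v * h23 + w * h33 := by
    intro u v w x y z e
    obtain ⟨e1, e2, e3⟩ := hind ((x : ℚ) - (u * h11 : ℤ)) ((y : ℚ) - (u * h12 + v * h22 : ℤ))
      ((z : ℚ) - (u * h13 + v * h23 + w * h33 : ℤ)) (by push_cast at e ⊢; linear_combination e)
    refine ⟨?_, ?_, ?_⟩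
    · exact_mod_cast sub_eq_zero.mp e1
    · exact_mod_cast sub_eq_zero.mp e2
    · exact_mod_cast sub_eq_zero.mp e3
  have read : ∀ {φ : K}, Mem θ b c φ → ∃ u v w : ℤ, ((c.1 : ℕ) : K) * φ =
      ((u * h11 : ℤ) : K) + ((u * h12 + v * h22 : ℤ) : K) * θ + ((u * h13 + v * h23 + w * h33 : ℤ) : K) * (θ ^ 2 / (b : K)) := by
    rintro φ ⟨g11, g12, g13, g22, g23, g33, u, v, w, hc2', e⟩
    rw [hc2] at hc2'
    simp only [List.cons.injEq, and_true] at hc2'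
    obtain ⟨rfl, rfl, rfl, rfl, rfl, rfl⟩ := hc2'
    exact ⟨u, v, w, e⟩
  obtain ⟨u₁, v₁, w₁, e₁⟩ := read h1
  obtain ⟨a1, -, -⟩ := key u₁ v₁ w₁ (c.1 * M) 0 0 (by push_cast at e₁ ⊢; linear_combination e₁)
  obtain ⟨u₂, v₂, w₂, e₂⟩ := read hθM
  obtain ⟨a2, b2, -⟩ := key u₂ v₂ w₂ 0 (c.1 * M) 0 (by push_cast at e₂ ⊢; linear_combination e₂)
  have hu₂ : u₂ = 0 := by rcases mul_eq_zero.mp a2.symm with h | h <;> [exact h; omega]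
  rw [hu₂, zero_mul, zero_add] at b2
  obtain ⟨u₃, v₃, w₃, e₃⟩ := read hθ₂M
  obtain ⟨a3, b3, c3⟩ := key u₃ v₃ w₃ 0 0 (c.1 * M) (by push_cast at e₃ ⊢; linear_combination e₃)
  have hu₃ : u₃ = 0 := by rcases mul_eq_zero.mp a3.symm with h | h <;> [exact h; omega]
  rw [hu₃, zero_mul, zero_add] at b3
  have hv₃ : v₃ = 0 := by rcases mul_eq_zero.mp b3.symm with h | h <;> [exact h; omega]
  rw [hu₃, hv₃, zero_mul, zero_mul, zero_add, zero_add] at c3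
  have hDM : (0 : ℤ) < c.1 * M := by
    have : (1 : ℤ) ≤ c.1 := by exact_mod_cast hD
    have : (1 : ℤ) ≤ M := by exact_mod_cast hM
    positivity
  have d11 : h11 ≤ c.1 * M := Int.le_of_dvd hDM ⟨u₁, by rw [a1, mul_comm]⟩
  have d22 : h22 ≤ c.1 * M := Int.le_of_dvd hDM ⟨v₂, by rw [b2, mul_comm]⟩
  have d33 : h33 ≤ c.1 * M := Int.le_of_dvd hDM ⟨w₃, by rw [c3, mul_comm]⟩
  intro h hh
  rw [hc2] at hh
  simp only [List.mem_cons, List.not_mem_nil, or_false] at hh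
  rcases hh with rfl | rfl | rfl | rfl | rfl | rfl <;> constructor <;> omega

include hdeg hab hab1 hθ in
/-- **The denominator of the code of an over-order is small**: if `1 ∈ J` then `den · N(J) ≤ 3`
(`J⁻¹ = 𝔟` is integral, `N(𝔟) ∈ 𝔟`, so `3 N(𝔟) J ⊆ 3 𝓞_K ⊆ ℤ⟨1, θ, θ₂⟩` and `den ∣ 3 N(𝔟) = 3 / N(J)`).
[cite: Cohen1993, §4.7.1] -/
theorem den_mul_absNorm_le_three {c : ℕ × List ℤ} (hc : Canon c) {J : FractionalIdeal (𝓞 K)⁰ K}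
    (hcJ : ∀ φ : K, Mem θ b c φ ↔ φ ∈ J) (h1 : (1 : K) ∈ J) :
    (c.1 : ℝ) * ((FractionalIdeal.absNorm J : ℚ) : ℝ) ≤ 3 := by
  have hJ0 : J ≠ 0 := fun h => one_ne_zero ((FractionalIdeal.mem_zero_iff (𝓞 K)⁰).mp (h ▸ h1))
  have hle : J⁻¹ ≤ 1 := by
    intro x hx
    have := (FractionalIdeal.mem_inv_iff hJ0).mp hx 1 h1
    rwa [mul_one] at this
  obtain ⟨B, hB⟩ := FractionalIdeal.le_one_iff_exists_coeIdeal.mp hle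
  have hB0 : B ≠ ⊥ := by
    rintro rfl
    rw [FractionalIdeal.coeIdeal_bot] at hB
    exact inv_ne_zero hJ0 hB.symm
  set n : ℕ := Ideal.absNorm B with hn
  have hn1 : 1 ≤ n := Nat.one_le_iff_ne_zero.mpr (by rw [hn, Ne, Ideal.absNorm_eq_zero_iff]; exact hB0)
  have hnB : ((n : 𝓞 K) : K) ∈ J⁻¹ := by
    rw [← hB]; exact FractionalIdeal.mem_coeIdeal_of_mem _ (Ideal.absNorm_mem B)
  -- `den ∣ 3 n`
  have hdvd : c.1 ∣ 3 * n := by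
    refine den_dvd_of_mul_mem_order θ b (fun c₀ c₁ c₂ h => coords_eq_zero hdeg hab hab1 hθ h) hc (by omega)
      fun φ hφ => ?_
    have hφJ := (hcJ φ).1 hφ
    have hint : ((n : 𝓞 K) : K) * φ ∈ (1 : FractionalIdeal (𝓞 K)⁰ K) := (FractionalIdeal.mem_inv_iff hJ0).mp hnB φ hφJ
    obtain ⟨ξ, hξ⟩ := (FractionalIdeal.mem_one_iff _).mp hint
    obtain ⟨c₀, c₁, c₂, e⟩ := three_mul_mem_order hdeg hab hab1 hθ ξ
    refine ⟨c₀, c₁, c₂, ?_⟩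
    rw [← e]
    change _ = 3 * algebraMap (𝓞 K) K ξ
    rw [hξ]; push_cast; ring
  -- `N(J) = 1/n`
  have hNJ : FractionalIdeal.absNorm J = (n : ℚ)⁻¹ := by
    have h := congrArg FractionalIdeal.absNorm hB
    rw [FractionalIdeal.coeIdeal_absNorm, map_inv₀] at h
    rw [← inv_inv (FractionalIdeal.absNorm J), ← h]
  have hle' : (c.1 : ℝ) ≤ 3 * n := by exact_mod_cast Nat.le_of_dvd (by omega) hdvd
  have hn0 : (0 : ℝ) < n := by exact_mod_cast hn1
  rw [hNJ, Rat.cast_inv, Rat.cast_natCast, ← div_eq_mul_inv, div_le_iff₀ hn0]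
  exact hle'

include hdeg hab hab1 hθ in
/-- **The entries of the code of an over-order are at most the denominator** (`1, θ, θ₂ ∈ 𝓞_K ⊆ J`).
[cite: Cohen1993, §4.7.1] -/
theorem entries_le_of_one_mem {c : ℕ × List ℤ} (hc : Canon c) {J : FractionalIdeal (𝓞 K)⁰ K}
    (hcJ : ∀ φ : K, Mem θ b c φ ↔ φ ∈ J) (h1 : (1 : K) ∈ J) : ∀ h ∈ c.2, 0 ≤ h ∧ h ≤ (c.1 : ℤ) := by
  have h := entries_le_den_mul θ b (fun c₀ c₁ c₂ h => coords_eq_zero hdeg hab hab1 hθ h) hc le_rfl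
    ((hcJ _).2 (by exact_mod_cast h1))
    ((hcJ _).2 (by rw [Nat.cast_one, one_mul]; simpa using mul_mem_of_isIntegral (isIntegral_theta hθ) h1))
    ((hcJ _).2 (by rw [Nat.cast_one, one_mul]; simpa using mul_mem_of_isIntegral (isIntegral_theta₂ hab hθ) h1))
  simpa using h

include hdeg hab hab1 hθ in
/-- **Codes of integral ideals**: for the canonical code of a nonzero integral ideal `𝔞` (as a fractional ideal),
`den ∣ 3` and every entry is at most `3 N(𝔞)` (`N(𝔞) ∈ 𝔞`). [cite: Cohen1993, §4.7.1] -/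
theorem integral_code_bounds {c : ℕ × List ℤ} (hc : Canon c) {A : Ideal (𝓞 K)} (hA : A ≠ ⊥)
    (hcA : ∀ φ : K, Mem θ b c φ ↔ φ ∈ (A : FractionalIdeal (𝓞 K)⁰ K)) :
    c.1 ∣ 3 ∧ ∀ h ∈ c.2, 0 ≤ h ∧ h ≤ 3 * (Ideal.absNorm A : ℤ) := by
  have hind := fun c₀ c₁ c₂ h => coords_eq_zero (K := K) hdeg hab hab1 hθ (c₀ := c₀) (c₁ := c₁) (c₂ := c₂) h
  have hdvd : c.1 ∣ 3 := by
    refine den_dvd_of_mul_mem_order θ b hind hc (by norm_num) fun φ hφ => ?_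
    obtain ⟨ξ, -, rfl⟩ := (FractionalIdeal.mem_coeIdeal _).mp ((hcA φ).1 hφ)
    obtain ⟨c₀, c₁, c₂, e⟩ := three_mul_mem_order hdeg hab hab1 hθ ξ
    exact ⟨c₀, c₁, c₂, by rw [← e]; push_cast; rfl⟩
  set n : ℕ := Ideal.absNorm A with hn
  have hn1 : 1 ≤ n := Nat.one_le_iff_ne_zero.mpr (by rw [hn, Ne, Ideal.absNorm_eq_zero_iff]; exact hA)
  have hnA : ((n : 𝓞 K) : K) ∈ (A : FractionalIdeal (𝓞 K)⁰ K) :=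
    FractionalIdeal.mem_coeIdeal_of_mem _ (Ideal.absNorm_mem A)
  have hnA' : (n : K) ∈ (A : FractionalIdeal (𝓞 K)⁰ K) := by simpa using hnA
  have h := entries_le_den_mul θ b hind hc hn1 ((hcA _).2 hnA')
    ((hcA _).2 (by rw [mul_comm]; exact mul_mem_of_isIntegral (isIntegral_theta hθ) hnA'))
    ((hcA _).2 (by rw [mul_comm]; exact mul_mem_of_isIntegral (isIntegral_theta₂ hab hθ) hnA'))
  refine ⟨hdvd, fun x hx => ⟨(h x hx).1, (h x hx).2.trans ?_⟩⟩
  have : (c.1 : ℤ) ≤ 3 := by exact_mod_cast Nat.le_of_dvd (by norm_num) hdvd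
  have hn0 : (0 : ℤ) ≤ n := by positivity
  nlinarith

end IdealCodes

section Summary

open scoped NumberField nonZeroDivisors

/-- **Summary (registered helper of the class-group stage)**: every nonzero fractional ideal of the pure cubic field
`ℚ(θ)`, `θ³ = ab²`, has a canonical lattice code. [cite: Cohen1993, §4.7.1] -/
theorem pureCubic_exists_canon_code : ∀ (a b : ℕ), Squarefree (a * b) → a * b ≠ 1 → ∀ (K : Type) [Field K] [NumberField K], Module.finrank ℚ K = 3 → ∀ θ : K, θ ^ 3 = ((a * b ^ 2 : ℕ) : K) → ∀ J : FractionalIdeal (𝓞 K)⁰ K, J ≠ 0 → ∃ c : ℕ × List ℤ, PureCubicCodes.Canon c ∧ ∀ φ : K, PureCubicCodes.Mem θ b c φ ↔ φ ∈ J :=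
  fun _ _ hab hab1 _ _ _ hdeg _ hθ J hJ => exists_canon_code hdeg hab hab1 hθ J hJ

end Summary

end Literature.NumberTheory.CubicFields
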